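import Literature.AlgebraicGeometry.Resolution.DerivativeIdealsCoordinates
import Mathlib.RingTheory.Smooth.Local
import Mathlib.RingTheory.Smooth.Field
import Mathlib.LinearAlgebra.TensorProduct.Pi
import Mathlib.Algebra.Module.SpanRankOperations
import HarnessLib

/-!
# Coordinates with dual derivations exist at smooth points (BGMW 2011 §3.5; Matsumura Thm. 30.6)

Topic: `Literature/AlgebraicGeometry/Resolution`. Bierstone–Grigoriev–Milman–Włodarczyk,
*Effective Hironaka resolution and its complexity*, arXiv:1206.3090, §3.5 (p. 7): on a smooth
variety "the dual sheaf of derivations `Der_K(𝒪_X)` is locally generated by the derivations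
`∂/∂uᵢ`", `u₁, …, uₙ` local coordinates — the input of every characteristic-sensitive step of
the resolution algorithm (Lemma 3.5.2, Lemma 3.6.4 (Giraud), §3.8), rendered in
`DerivativeIdealsCoordinates.lean` as the structure `CoordSystem R 𝔪 ι` (generators `uᵢ` of `𝔪`
with `R`-derivations `δᵢ`, `δᵢ(uⱼ) = δᵢⱼ`), available there only at the `k`-points of `𝔸ⁿ`.

This file PROVES that such coordinate systems exist at EVERY point of a smooth scheme over a
perfect field, in the local-algebra form: let `A` be a local ring, essentially of finite type
and formally smooth over a field `k` (e.g. `𝒪_{X,x}` for `X` smooth over `k`), whose residue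
field `K` is formally smooth over `k` (automatic when `k` is perfect, Mathlib
`Algebra.FormallySmooth.of_perfectField`; false in general over imperfect fields). Then EVERY
minimal system of generators `u₁, …, u_d` of `𝔪_A` admits dual `k`-derivations
`δ₁, …, δ_d ∈ Der_k(A)`, `δᵢ(uⱼ) = δᵢⱼ` (`exists_coordSystem_coord_eq`) — condition (2) of
Matsumura, *Commutative Ring Theory*, Thm. 30.6 (ii) ("there exist `D₁, …, Dₙ ∈ Der_k(R)` and
`a₁, …, aₙ ∈ R` such that `Dᵢ aⱼ = δᵢⱼ`"), established here for the local rings of smooth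
schemes over perfect fields and for EVERY minimal generating system `aⱼ` of `𝔪`.
Proof (over Mathlib): by the Jacobian criterion for formally smooth local algebras
(`Algebra.FormallySmooth.iff_injective_cotangentComplexBaseChange`, applied to the presentation
`0 → 𝔪 → A → K → 0` of the formally smooth `k`-algebra `K`), `K ⊗_A 𝔪 → K ⊗_A Ω_{A/k}` is
injective; `K ⊗_A Aᵈ → K ⊗_A 𝔪` (from `eᵢ ↦ uᵢ`) is a surjection between `K`-spaces of dimension
`d`, hence injective; so `Aᵈ → Ω_{A/k}`, `eᵢ ↦ duᵢ`, is injective after `K ⊗_A −`, hence SPLIT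
injective (`Ω_{A/k}` being finite free over the local ring `A`:
`IsLocalRing.split_injective_iff_lTensor_residueField_injective`); composing a retraction with
the coordinate projections and the universal derivation gives the `δᵢ`.

* `finrank_residueField_tensor_pi`, `finrank_residueField_tensor_ideal` — dimension counts;
* (`Ω_{A/k}` is finite free: Mathlib `Module.free_of_flat_of_isLocalRing`);
* `exists_retraction_of_formallySmooth` — `eᵢ ↦ duᵢ` is split injective;
* `exists_coordSystem_coord_eq` — the theorem; `exists_coordSystem_coord_eq_of_perfectField`,
  `nonempty_coordSystem_of_perfectField` — over a perfect field.

## Sources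

* [BGMW 2011] §3.5 (p. 7, arXiv numbering). [BierstoneGrigorievMilmanWlodarczyk2011]
* H. Matsumura, *Commutative Ring Theory*, CUP 1986, §30, Thm. 30.6 (ii) (p. 240 of the book =
  PDF p. 254–255 of the held copy): conditions (1)–(5) on `Der_k(R)` of a regular local ring.
  [Matsumura1987]
-/

namespace Literature.AlgebraicGeometry.Resolution

open IsLocalRing TensorProduct KaehlerDifferential

universe u v w

section LocalAlgebra

variable {k : Type u} {A : Type v} [Field k] [CommRing A] [IsLocalRing A] [Algebra k A]

/-! ## Dimension counts over the residue field -/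

/-- `dim_K (K ⊗_A A^ι) = |ι|` for the residue field `K` of the local ring `A`. [folklore] -/
theorem finrank_residueField_tensor_pi (ι : Type w) [Fintype ι] [DecidableEq ι] :
    Module.finrank (ResidueField A) (ResidueField A ⊗[A] (ι → A)) = Fintype.card ι := by
  rw [(TensorProduct.piScalarRight A (ResidueField A) (ResidueField A) ι).finrank_eq,
    Module.finrank_pi]

/-- `dim_K (K ⊗_A I)` is the minimal number of generators of the finitely generated ideal `I`
(Nakayama). [folklore] -/
theorem finrank_residueField_tensor_ideal (I : Ideal A) (hI : I.FG) :
    Module.finrank (ResidueField A) (ResidueField A ⊗[A] I) = I.spanFinrank := by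
  rw [Module.finrank_eq_spanFinrank_of_free, TensorProduct.spanFinrank_top_eq_of_residueField I hI]

/-! ## The Jacobian criterion, dualized -/

variable [Algebra.EssFiniteType k A] [Algebra.FormallySmooth k A]

variable [Algebra.FormallySmooth k (ResidueField A)]

/-- **The differentials of a minimal system of generators of `𝔪` are part of a basis of
`Ω_{A/k}`**: for `A` local, essentially of finite type and formally smooth over `k` with formally
smooth residue field `K`, and `u : ι → 𝔪` a minimal generating family (`|ι|` = the minimal
number of generators), the `A`-linear map `A^ι → Ω_{A/k}`, `eᵢ ↦ duᵢ`, has a retraction.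
(Jacobian criterion `K ⊗ 𝔪 ↪ K ⊗ Ω`, Mathlib
`Algebra.FormallySmooth.iff_injective_cotangentComplexBaseChange`, plus
`IsLocalRing.split_injective_iff_lTensor_residueField_injective`.) [folklore] -/
theorem exists_retraction_of_formallySmooth {ι : Type w} [Fintype ι] [DecidableEq ι] (u : ι → A)
    (hu : Ideal.span (Set.range u) = maximalIdeal A)
    (hcard : Fintype.card ι = (maximalIdeal A).spanFinrank) :
    ∃ ρ : Ω[A⁄k] →ₗ[A] (ι → A),
      ρ ∘ₗ Fintype.linearCombination A (fun i => D k A (u i)) = LinearMap.id := by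
  -- `Ω_{A/k}` is finite projective over the local ring `A`, hence finite free
  haveI : Module.Free A Ω[A⁄k] := Module.free_of_flat_of_isLocalRing
  set K := ResidueField A
  -- the presentation `0 → 𝔪 → A → K → 0`
  set I : Ideal A := RingHom.ker (algebraMap A K) with hIdef
  have hI : I = maximalIdeal A := by rw [hIdef, ResidueField.algebraMap_eq, ker_residue]
  have hmem : ∀ i, u i ∈ I := fun i => hI ▸ hu ▸ Ideal.subset_span ⟨i, rfl⟩
  have hIfg : I.FG := Submodule.fg_def.mpr ⟨Set.range u, Set.finite_range u, hu.trans hI.symm⟩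
  -- Jacobian criterion: `K ⊗ 𝔪 → K ⊗ Ω` is injective since `K` is formally smooth over `k`
  have h₃ : maximalIdeal K ≤ RingHom.ker (algebraMap K K) := by
    intro x hx
    have hx' : ¬IsUnit x := (IsLocalRing.mem_maximalIdeal x).mp hx
    rw [isUnit_iff_ne_zero, not_not] at hx'
    simp [hx']
  have hinj : Function.Injective (cotangentComplexBaseChange k K A K) :=
    (Algebra.FormallySmooth.iff_injective_cotangentComplexBaseChange (R := k) (S := K) A K
      residue_surjective hIfg h₃).mp ‹_›
  -- `α : A^ι → 𝔪`, `eᵢ ↦ uᵢ`, is surjective, and `K ⊗ α` is a surjection between spaces of the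
  -- same dimension `|ι|`, hence injective
  let v : ι → I := fun i => ⟨u i, hmem i⟩
  let α : (ι → A) →ₗ[A] I := Fintype.linearCombination A v
  have hαsurj : Function.Surjective α := by
    rw [← LinearMap.range_eq_top, Fintype.range_linearCombination]
    apply Submodule.map_injective_of_injective I.injective_subtype
    rw [Submodule.map_subtype_top, Submodule.map_span, ← Set.range_comp]
    change Submodule.span A (Set.range u) = I
    exact hu.trans hI.symm
  haveI : Module.Finite A I := Module.Finite.iff_fg.mpr hIfg
  have hαinj : Function.Injective (α.lTensor K) := by
    rw [← LinearMap.baseChange_eq_ltensor]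
    have hsurj : Function.Surjective (α.baseChange K) := by
      rw [LinearMap.baseChange_eq_ltensor]
      exact LinearMap.lTensor_surjective K hαsurj
    refine (LinearMap.injective_iff_surjective_of_finrank_eq_finrank ?_).mpr hsurj
    rw [finrank_residueField_tensor_pi, finrank_residueField_tensor_ideal I hIfg, hcard, hI]
  -- `ψ : A^ι → Ω`, `eᵢ ↦ duᵢ`; `K ⊗ ψ = (K ⊗ 𝔪 → K ⊗ Ω) ∘ (K ⊗ α)`
  set ψ : (ι → A) →ₗ[A] Ω[A⁄k] := Fintype.linearCombination A (fun i => D k A (u i)) with hψdef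
  have hψ : (ψ.lTensor K : K ⊗[A] (ι → A) → K ⊗[A] Ω[A⁄k]) =
      (cotangentComplexBaseChange k K A K) ∘ (α.lTensor K) := by
    suffices h : ψ.lTensor K =
        ((cotangentComplexBaseChange k K A K).restrictScalars A) ∘ₗ (α.lTensor K) by
      exact congrArg (fun f : K ⊗[A] (ι → A) →ₗ[A] K ⊗[A] Ω[A⁄k] => (f : _ → _)) h
    apply TensorProduct.ext'
    intro a f
    rw [LinearMap.lTensor_tmul, LinearMap.comp_apply, LinearMap.lTensor_tmul,
      LinearMap.restrictScalars_apply, cotangentComplexBaseChange_tmul, kerToTensor_apply]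
    rw [hψdef, Fintype.linearCombination_apply]
    have hαf : ((α f : I) : A) = ∑ i, f i * u i := by
      change ((Fintype.linearCombination A v f : I) : A) = _
      rw [Fintype.linearCombination_apply]
      simp [v]
    rw [hαf, map_sum, tmul_sum, tmul_sum, Finset.smul_sum]
    refine Finset.sum_congr rfl fun i _ => ?_
    have key : ∀ (r : A) (m : Ω[A⁄k]),
        a • ((1 : K) ⊗ₜ[A] (r • m)) = (a * algebraMap A K r) ⊗ₜ[A] m := by
      intro r m
      rw [tmul_smul, smul_tmul', smul_tmul', Algebra.smul_def r (1 : K), mul_one]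
      rfl
    have hres : algebraMap A K (u i) = 0 := by
      rw [ResidueField.algebraMap_eq, residue_eq_zero_iff]
      exact hu ▸ Ideal.subset_span ⟨i, rfl⟩
    rw [Derivation.leibniz, tmul_add, smul_add, key, key, hres, mul_zero, zero_tmul, add_zero,
      tmul_smul, smul_tmul', Algebra.smul_def, mul_comm a]
  have hψinj : Function.Injective (ψ.lTensor K) := by
    rw [hψ]
    exact hinj.comp hαinj
  exact (IsLocalRing.split_injective_iff_lTensor_residueField_injective ψ).mpr hψinj

/-- **Coordinates with dual derivations at smooth points** (BGMW §3.5: "`Der_K(𝒪_X)` is locally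
generated by the derivations `∂/∂uᵢ`"; condition (2) of Matsumura Thm. 30.6 (ii)): for `A`
local, essentially of finite type and formally smooth over a field `k`, with residue field
formally smooth over `k`, every minimal system of generators `u : ι → 𝔪_A` extends to a
`CoordSystem k 𝔪_A ι` — there are `k`-derivations `δᵢ` of `A` with `δᵢ(uⱼ) = δᵢⱼ`. [folklore] -/
theorem exists_coordSystem_coord_eq {ι : Type w} [Fintype ι] [DecidableEq ι] (u : ι → A)
    (hu : Ideal.span (Set.range u) = maximalIdeal A)
    (hcard : Fintype.card ι = (maximalIdeal A).spanFinrank) :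
    ∃ c : CoordSystem k (maximalIdeal A) ι, c.coord = u := by
  obtain ⟨ρ, hρ⟩ := exists_retraction_of_formallySmooth (k := k) u hu hcard
  have hρu : ∀ j, ρ (D k A (u j)) = Pi.single j 1 := by
    intro j
    have := LinearMap.congr_fun hρ (Pi.single j 1)
    rwa [LinearMap.comp_apply, Fintype.linearCombination_apply_single, one_smul,
      LinearMap.id_apply] at this
  refine ⟨⟨u, fun i => (LinearMap.proj i ∘ₗ ρ).compDer (D k A), hu, fun i => ?_,
    fun i j hij => ?_⟩, rfl⟩
  · change (LinearMap.proj i ∘ₗ ρ) (D k A (u i)) = 1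
    rw [LinearMap.comp_apply, hρu, LinearMap.proj_apply, Pi.single_eq_same]
  · change (LinearMap.proj i ∘ₗ ρ) (D k A (u j)) = 0
    rw [LinearMap.comp_apply, hρu, LinearMap.proj_apply, Pi.single_eq_of_ne hij]

end LocalAlgebra

/-! ## Over a perfect field -/

section Perfect

variable {k : Type u} {A : Type v} [Field k] [PerfectField k] [CommRing A] [IsLocalRing A]
  [Algebra k A] [Algebra.EssFiniteType k A]

/-- The residue field of a local algebra essentially of finite type over a perfect field is
formally smooth over it (Mathlib `Algebra.FormallySmooth.of_perfectField`). [folklore] -/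
theorem formallySmooth_residueField_of_perfectField :
    Algebra.FormallySmooth k (ResidueField A) := by
  haveI : Algebra.EssFiniteType k (ResidueField A) :=
    inferInstanceAs (Algebra.EssFiniteType k (A ⧸ maximalIdeal A))
  infer_instance

variable [Algebra.FormallySmooth k A]

/-- **Coordinates with dual derivations at every point of a smooth scheme over a perfect
field** (BGMW §3.5; condition (2) of Matsumura Thm. 30.6 (ii)), local-algebra form: for `A`
local, essentially of finite type and formally smooth over a perfect field `k` (e.g. `𝒪_{X,x}`,
`X` smooth over `k`, `x` any point), every minimal system of generators of `𝔪_A` extends to a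
`CoordSystem k 𝔪_A ι`. [folklore] -/
theorem exists_coordSystem_coord_eq_of_perfectField {ι : Type w} [Fintype ι] [DecidableEq ι]
    (u : ι → A) (hu : Ideal.span (Set.range u) = maximalIdeal A)
    (hcard : Fintype.card ι = (maximalIdeal A).spanFinrank) :
    ∃ c : CoordSystem k (maximalIdeal A) ι, c.coord = u := by
  haveI := formallySmooth_residueField_of_perfectField (k := k) (A := A)
  exact exists_coordSystem_coord_eq (k := k) u hu hcard

/-- In particular a coordinate system with dual derivations indexed by
`Fin (spanFinrank 𝔪_A)` exists (the index type used by `HasSNCWith`, `MarkedIdeals.lean`).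
[folklore] -/
theorem nonempty_coordSystem_of_perfectField [IsNoetherianRing A] :
    Nonempty (CoordSystem k (maximalIdeal A) (Fin (maximalIdeal A).spanFinrank)) := by
  obtain ⟨s, hs, hspan⟩ := Submodule.FG.exists_span_finset_card_eq_spanFinrank
    (maximalIdeal A).fg_of_isNoetherianRing
  classical
  let e := (Finset.equivFinOfCardEq hs).symm
  have hrange : Set.range (fun i : Fin (maximalIdeal A).spanFinrank => ((e i : s) : A)) = s := by
    ext x
    constructor
    · rintro ⟨i, rfl⟩
      exact (e i).2
    · intro hx
      exact ⟨e.symm ⟨x, hx⟩, by simp⟩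
  have hu : Ideal.span (Set.range fun i : Fin (maximalIdeal A).spanFinrank => ((e i : s) : A)) =
      maximalIdeal A := by rw [hrange]; exact hspan
  obtain ⟨c, -⟩ := exists_coordSystem_coord_eq_of_perfectField (k := k) _ hu (by simp)
  exact ⟨c⟩

end Perfect

end Literature.AlgebraicGeometry.Resolution
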